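import Summits.QuantumFields.Balaban3D.Carriers.StepSeries

/-!
# Lane `pub-balaban3d` — carrier layer p1 (`Carriers.Series`): THE TOWER OF A SERIES — the interaction sum `Pint` and the vacuum energies
# `E^{(k)}` DEFINED from the expansion data (R-FL), the R-RN BARRIERS DEFINED as the printed step bounds (55)·(58) / p. 272 L32–33 (v1.2),
# the step pieces `seriesPieces`, and LQB's leaves `PintSucc`, `Estep62`, `NoInteraction0` BY `rfl`

v1.2 (ruling R-RN made honest): the sandwich barriers of the version selection are no longer free data.  `upperOf B 𝔖 C k` IS the right-hand
side of the upper step bound (55)·(58) pp. 269–270 — `LF_{k+1}(V)[−(1/g_{k+1}²)A^η(U_{k+1}(h,V)) − E_k + (log σ₀ + d(𝔤)log g_k)|B(Λ_{k+1})*| +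
log Z^{(k)} + Σ𝒫_j + Z-terms + remainders + log(fluctuation integral)]` — and `lowerOf B 𝔖 C k` IS the lower step bound at the trivial history
(p. 265 L21–28 / p. 272 L32–33, LQB `Bound55Lower`), both read off the barrier-free PRE-TOWER `preInput` (the tower's `LF`, main term, `E_k`,
`Z`-terms, remainders and `χ` do not depend on the densities); seat p4's pinning hypotheses `hupper`/`hlower` of
`Bound55Tower.bound55_of_select`/`bound55Lower_of_select` then hold for EVERY series tower BY `rfl` (`withSeries_upper`, `withSeries_lower`),
and `ρ_{k+1}` is the RN transport of `ρ_k` re-selected inside `[lower, upper]` (`Carriers.Run.run3_rho_succ_sandwich`; all versions agree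
dV-a.e., `run3_rho_succ_ae_eq_rn`).  [folklore] bookkeeping; nothing of CMP 102 is asserted.
-/

open MeasureTheory Finset
open scoped Matrix

namespace Summit.QuantumFields.Balaban3D.Carriers

open Literature.MathematicalPhysics.QuantumFieldTheory.Balaban1983to89
open Literature.MathematicalPhysics.QuantumFieldTheory.Balaban1983to89.TreeLengthTorus (tsys TPt)
open Literature.MathematicalPhysics.QuantumFieldTheory.Balaban1985CMP102
open Literature.MathematicalPhysics.QuantumFieldTheory.Balaban1985CMP102.Setting

variable {L : ℕ} {S : Scales L} {G : Type} [GaugeGroup G] [MeasurableSpace G] [HaarData G]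

/-! ## §3 The tower over a series: barriers, `Pint`, `E^{(k)}` DEFINED; the leaves `NoInteraction0`/`PintSucc`/`Estep62` by `rfl` -/

namespace TowerBase

variable {V : Type} [NormedAddCommGroup V] [NormedSpace ℂ V] {Nc : ℕ → ℕ} [∀ k, NeZero (Nc k)]
  (B : TowerBase S G) (𝔖 : ∀ k, StepSeries S G V (Nc k) k) (C : ∀ k, PiecesParams S k)

/-- The PRE-TOWER input of a series: ZERO barriers — only used to read off the (barrier-independent) functional `LF`, main term, `E_k`,
`Z`-terms, remainders and `χ` of the series' tower. [folklore] -/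
noncomputable def preInput : TowerInput S G where
  ε₁ := B.ε₁
  av := B.av
  avgAC := B.avgAC
  reg := B.reg
  Uk := B.Uk
  lower := fun _ _ => 0
  upper := fun _ _ => 0
  lower_nonneg := fun _ _ => le_rfl
  upper_nonneg := fun _ _ => le_rfl
  M₁ := B.M₁
  Rcol := B.Rcol
  b₀ := B.b₀
  p₀ := B.p₀
  κ₀ := B.κ₀
  W := B.W
  UkH := B.UkH
  UkH_triv := B.UkH_triv
  Pint := pintOfSeries B.M₁ B.Rcol 𝔖
  zcoef := B.zcoef
  rcoef := B.rcoef
  Estep := estepOfSeries 𝔖 C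

/-- THE EXPONENT OF THE UPPER STEP BOUND (55)·(58) pp. 269–270 at history `h'` and field `V` on `T^{(k+1)}`: «−(1/g_{k+1}²)A^η(U_{k+1}) − E_k
+ log σ₀|B(Λ_{k+1})*| + d(𝔤) log g_k|B(Λ_{k+1})*| + log Z^{(k)}(B(Λ_{k+1}), U_{k+1}) + Σ_{j=1}^k Σ_{Y_j} 𝒫_j(Y_j, U_{k+1}) + (the constants
in (41)) + log ∫dμ χ exp[𝒱 + O(…)]» — in the term order of LQB's `B10SectAGathering.Bound55` / seat p4's `bound55_of_select`. [cite: Balaban1985UV3, (55) p.269 + (58) p.270] -/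
noncomputable def exp55 (k : ℕ) (U : GaugeField S.P (k + 1) G) (h' : Hist S.P (k + 1)) : ℝ :=
  -(((B.preInput 𝔖 C).towerWith fun _ => True).mainT (k + 1) h' U) - ((B.preInput 𝔖 C).towerWith fun _ => True).Ecst k
    + ((C k).logσ₀ + (C k).dg * Real.log (S.gk k)) * (C k).starB h'
    + (𝔖 k).logZU h' U + (𝔖 k).Pold B.M₁ B.Rcol h' U
    + ((B.preInput 𝔖 C).towerWith fun _ => True).Zterm k (Hist.proj h') + ((B.preInput 𝔖 C).towerWith fun _ => True).Rm k
    + (𝔖 k).logFl h' U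

/-- **THE UPPER BARRIER := the right-hand side of the printed upper step bound (55)·(58)**: `LF_{k+1}(V)[exp55]`. [cite: Balaban1985UV3, (55) p.269 + (58) p.270] -/
noncomputable def upperOf (k : ℕ) (U : GaugeField S.P (k + 1) G) : ℝ :=
  ((B.preInput 𝔖 C).towerWith fun _ => True).LF (k + 1) U (B.exp55 𝔖 C k U)

/-- **THE LOWER BARRIER := the printed lower step bound at the trivial history** (p. 265 L21–28 at `k = 0`; p. 272 L32–33 «The lower bound is
proved in the same way, with all simplifications coming from the fact that Ω_{k+1} = T_η»; LQB `Bound55Lower`): `χ_{k+1}(V)·exp[−(1/g_{k+1}²)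
A^η(U_{k+1}(V)) − E_k + (log σ₀ + d(𝔤)log g_k)|T₁^{(k+1)*}| + log Z^{(k)} + Σ𝒫_j − remainders + log(fluctuation integral)]`, in the term order
of seat p4's `bound55Lower_of_select`. [cite: Balaban1985UV3, p.272 L32–33 + (47) p.267] -/
noncomputable def lowerOf (k : ℕ) (U : GaugeField S.P (k + 1) G) : ℝ :=
  ((B.preInput 𝔖 C).towerWith fun _ => True).chi (k + 1) U *
    Real.exp (-(((B.preInput 𝔖 C).towerWith fun _ => True).mainT (k + 1) (Hist.triv S.P (k + 1)) U)
      - ((B.preInput 𝔖 C).towerWith fun _ => True).Ecst k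
      + ((C k).logσ₀ + (C k).dg * Real.log (S.gk k)) * (C k).starB (Hist.triv S.P (k + 1))
      + (𝔖 k).logZU (Hist.triv S.P (k + 1)) U + (𝔖 k).Pold B.M₁ B.Rcol (Hist.triv S.P (k + 1)) U
      - ((B.preInput 𝔖 C).towerWith fun _ => True).Rm k + (𝔖 k).logFl (Hist.triv S.P (k + 1)) U)

/-- The lower barrier is non-negative (`χ ∈ {0, 1}` times an exponential). [folklore] -/
theorem lowerOf_nonneg (k : ℕ) (U : GaugeField S.P (k + 1) G) : 0 ≤ B.lowerOf 𝔖 C k U := by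
  refine mul_nonneg ?_ (Real.exp_pos _).le
  show 0 ≤ chiSmall _ _ _
  unfold chiSmall
  split_ifs <;> norm_num

/-- The upper barrier is non-negative (a value of the positive functional `LF`, `Carriers.lf_nonneg`). [folklore] -/
theorem upperOf_nonneg (k : ℕ) (U : GaugeField S.P (k + 1) G) : 0 ≤ B.upperOf 𝔖 C k U :=
  lf_nonneg B.W (k + 1) U _

end TowerBase

/-- THE TOWER INPUT OF A SERIES: `Pint` and `Estep` DEFINED from the expansion data (R-FL), the barriers DEFINED as the printed step bounds
(v1.2). [cite: Balaban1985UV3, (43) p.266 + (55) p.269 + (62) p.271] -/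
noncomputable def TowerBase.withSeries {V : Type} [NormedAddCommGroup V] [NormedSpace ℂ V] {Nc : ℕ → ℕ} [∀ k, NeZero (Nc k)]
    (B : TowerBase S G) (𝔖 : ∀ k, StepSeries S G V (Nc k) k) (C : ∀ k, PiecesParams S k) : TowerInput S G where
  ε₁ := B.ε₁
  av := B.av
  avgAC := B.avgAC
  reg := B.reg
  Uk := B.Uk
  lower := B.lowerOf 𝔖 C
  upper := B.upperOf 𝔖 C
  lower_nonneg := B.lowerOf_nonneg 𝔖 C
  upper_nonneg := B.upperOf_nonneg 𝔖 C
  M₁ := B.M₁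
  Rcol := B.Rcol
  b₀ := B.b₀
  p₀ := B.p₀
  κ₀ := B.κ₀
  W := B.W
  UkH := B.UkH
  UkH_triv := B.UkH_triv
  Pint := pintOfSeries B.M₁ B.Rcol 𝔖
  zcoef := B.zcoef
  rcoef := B.rcoef
  Estep := estepOfSeries 𝔖 C

section Leaves

variable {V : Type} [NormedAddCommGroup V] [NormedSpace ℂ V] {Nc : ℕ → ℕ} [∀ k, NeZero (Nc k)]
  (B : TowerBase S G) (𝔖 : ∀ k, StepSeries S G V (Nc k) k) (C : ∀ k, PiecesParams S k)

/-- THE v1 STEP PIECES of the series' tower: `pieces3` at the DEFINED `StepData` (R-FL: «the instantiation used by the end theorem must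
be the v1 one»). [cite: Balaban1985UV3, (55)–(63) pp.269–272] -/
noncomputable def seriesPieces (k : ℕ) : B10SectAGathering.StepPieces (B.withSeries 𝔖 C).tower3.toTowerRun k :=
  (B.withSeries 𝔖 C).pieces3 k ((𝔖 k).toStepData B.M₁ B.Rcol (B.Rret k)) (C k)

/-- **LQB leaf `PintSucc` BY `rfl`** for the series' tower (LEAF-LEDGER C11). [cite: Balaban1985UV3, (36) p.265 + (41) p.266] -/
theorem pintSucc_series (k : ℕ) : B10SectAGathering.PintSucc (seriesPieces B 𝔖 C k) := fun _ _ => rfl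

/-- **LQB leaf `Estep62` BY `rfl`** for the series' tower (LEAF-LEDGER C12; R-E). [cite: Balaban1985UV3, (62) p.271] -/
theorem estep62_series (k : ℕ) : B10SectAGathering.Estep62 (seriesPieces B 𝔖 C k) := rfl

/-- **No interaction at `k = 0`** (`Pint 0 = 0`, LEAF-LEDGER B12 `noInt0`): LQB `B10LargeField.NoInteraction0` BY `rfl`. [cite: Balaban1985UV3, (1) p.256] -/
theorem noInteraction0_series : B10LargeField.NoInteraction0 (B.withSeries 𝔖 C).tower3.toTowerRun := fun _ _ => rfl

/-- **R-FL (ii) / R-44: `Pint (k+1) = PoldIn_k + PY_k + PYZ_k` unfolded** (the series tower's interaction sum one step up; with `seriesPieces_PoldIn`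
this is the «Pint = Σ_j Σ_(y;c) oldVal» identification seat p2's `Bound46Series.abs_pint_succ_le` consumes). [cite: Balaban1985UV3, (43) p.266] -/
theorem withSeries_Pint_succ (k : ℕ) (h : Hist S.P (k + 1)) (U : GaugeField S.P (k + 1) G) :
    (B.withSeries 𝔖 C).Pint (k + 1) h U = (𝔖 k).PoldIn B.M₁ B.Rcol h U + (𝔖 k).PY h U + (𝔖 k).PYZ h U := rfl

/-- The interaction sum of `ρ₀` is `0` ((1): no interaction). [folklore] -/
theorem withSeries_Pint_zero (h : Hist S.P 0) (U : GaugeField S.P 0 G) : (B.withSeries 𝔖 C).Pint 0 h U = 0 := rfl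

/-- **The OLD-TERM SUM of the series' pieces IS the (43) sum over the concrete index geometry** (seat p5's `hPold` shape, by `rfl`):
all blocks `y ∈ Ω_k^{(j)} ∩ M₁L^jηZ³`, admissible bonds, degrees `n ≤ Ndeg j`. [cite: Balaban1985UV3, (43) p.266 + (58) p.270] -/
theorem seriesPieces_Pold (k : ℕ) (h : Hist S.P (k + 1)) (U : GaugeField S.P (k + 1) G) :
    (seriesPieces B 𝔖 C k).Pold h U =
      ∑ j ∈ Icc 1 k, ∑ y ∈ oldBlocks B.M₁ B.Rcol h j, ∑ n ∈ range ((𝔖 k).Ndeg j + 1),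
        ∑ c ∈ Fintype.piFinset (fun _ : Fin n => oldBonds B.M₁ B.Rcol h j y), (𝔖 k).oldVal h U j y n c := rfl

/-- **The RETAINED old-term sum IS the same (43) sum with the dropped terms «Y_j ⊄ Ω_{k+1}» replaced by `0`** (seat p5's `hPoldIn` shape, by
`rfl`). [cite: Balaban1985UV3, p.272 L29–31] -/
theorem seriesPieces_PoldIn (k : ℕ) (h : Hist S.P (k + 1)) (U : GaugeField S.P (k + 1) G) :
    (seriesPieces B 𝔖 C k).PoldIn h U =
      ∑ j ∈ Icc 1 k, ∑ y ∈ oldBlocks B.M₁ B.Rcol h j, ∑ n ∈ range ((𝔖 k).Ndeg j + 1),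
        ∑ c ∈ Fintype.piFinset (fun _ : Fin n => oldBonds B.M₁ B.Rcol h j y),
          (if Drop B.M₁ B.Rcol h j y n c then 0 else (𝔖 k).oldVal h U j y n c) := rfl

/-- **The RETAINED chart sum IS the (59) sum over the DEFINED blocks and radius** (R-OMEGA; seat p5's `hPprU` shape, by `rfl`):
`PprU h U = Σ_{X ⊆ ΩblkOf … h, 𝓛(X) < Rret k} Re Ψ_X(B_X(h,U))`. [cite: Balaban1985UV3, (59) p.270] -/
theorem seriesPieces_PprU (k : ℕ) (h : Hist S.P (k + 1)) (U : GaugeField S.P (k + 1) G) :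
    (seriesPieces B 𝔖 C k).PprU h U =
      ∑ X ∈ Finset.univ.filter (fun X : (tsys 3 (Nc k)).Dom => X.1 ⊆ ΩblkOf B.M₁ B.Rcol (Nc k) h ∧ (tsys 3 (Nc k)).dj X < B.Rret k),
        (𝔖 k).act h X U := rfl

/-- **The `hZ` input of C3/C4/C6 for every series tower, a THEOREM** (R-OMEGA/R-OMEGA′): `#(blocks ∖ Ω_{k+1}(h)) ≤ |Z_k(h)|` at the pieces' `Zvol`.
[cite: Balaban1985UV3, p.270 L31] -/
theorem seriesPieces_hZ (k : ℕ) (h : Hist S.P (k + 1)) :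
    (((Finset.univ : Finset (TPt 3 (Nc k))) \ ΩblkOf B.M₁ B.Rcol (Nc k) h).card : ℝ) ≤ (seriesPieces B 𝔖 C k).Zvol h := by
  show (_ : ℝ) ≤ ((ZVol B.M₁ B.Rcol (k + 1) h k : ℕ) : ℝ)
  exact_mod_cast card_compl_ΩblkOf_le_ZVol B.M₁ B.Rcol (Nc k) h

/-- **Seat p4's `hupper` BY `rfl`, for every series tower**: the upper barrier IS the right-hand side of (55)·(58) for THAT tower (any slot):
its functional `LF_{k+1}`, main term, `E_k`, `Z`-terms and remainders, with the parameters' `log σ₀`, `d(𝔤)`, `|B(Λ_{k+1})*|` and the series'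
`log Z^{(k)}`, `Σ𝒫_j`, `log(fluctuation integral)` (= the fields of `seriesPieces B 𝔖 C k`, definitionally). [cite: Balaban1985UV3, (55) p.269 + (58) p.270] -/
theorem withSeries_upper (slot : ℕ → Prop) (k : ℕ) (U : GaugeField S.P (k + 1) G) :
    (B.withSeries 𝔖 C).upper k U =
      ((B.withSeries 𝔖 C).towerWith slot).LF (k + 1) U (fun h' =>
        -(((B.withSeries 𝔖 C).towerWith slot).mainT (k + 1) h' U) - ((B.withSeries 𝔖 C).towerWith slot).Ecst k
        + ((C k).logσ₀ + (C k).dg * Real.log (S.gk k)) * (C k).starB h'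
        + (𝔖 k).logZU h' U + (𝔖 k).Pold B.M₁ B.Rcol h' U
        + ((B.withSeries 𝔖 C).towerWith slot).Zterm k (Hist.proj h') + ((B.withSeries 𝔖 C).towerWith slot).Rm k
        + (𝔖 k).logFl h' U) := rfl

/-- **Seat p4's `hlower` BY `rfl`, for every series tower**: the lower barrier IS the printed lower step bound at the trivial history for
THAT tower (any slot). [cite: Balaban1985UV3, p.272 L32–33 + (47) p.267] -/
theorem withSeries_lower (slot : ℕ → Prop) (k : ℕ) (U : GaugeField S.P (k + 1) G) :
    (B.withSeries 𝔖 C).lower k U =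
      ((B.withSeries 𝔖 C).towerWith slot).chi (k + 1) U *
        Real.exp (-(((B.withSeries 𝔖 C).towerWith slot).mainT (k + 1) (Hist.triv S.P (k + 1)) U)
          - ((B.withSeries 𝔖 C).towerWith slot).Ecst k
          + ((C k).logσ₀ + (C k).dg * Real.log (S.gk k)) * (C k).starB (Hist.triv S.P (k + 1))
          + (𝔖 k).logZU (Hist.triv S.P (k + 1)) U + (𝔖 k).Pold B.M₁ B.Rcol (Hist.triv S.P (k + 1)) U
          - ((B.withSeries 𝔖 C).towerWith slot).Rm k + (𝔖 k).logFl (Hist.triv S.P (k + 1)) U) := rfl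

/-- The FLUCTUATION MODEL of LQB (`B10Eq24Cumulant.FluctuationModel`, seat p5's C3/C4 hypothesis structure) INSTANTIATED at the series'
pieces with `C₀ = 0`: the model's measure is `μ` restricted to the box and its potential is `𝒱`, so `logFl = log ∫ exp V dν` holds with
equality — given the (α)-facts about the data that the model records (box of positive finite measure ≤ 1, `𝒱` a.e.-measurable and
a.e.-bounded). [cite: Balaban1985UV3, (58) p.270] -/
noncomputable def flucModel (k : ℕ) (hμ : IsProbabilityMeasure (𝔖 k).μ)
    (hbox : ∀ h, (𝔖 k).μ ((𝔖 k).box h) ≠ 0) (N : ℕ)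
    (hV : ∀ h U, AEMeasurable ((𝔖 k).𝒱 h U) (((𝔖 k).μ).restrict ((𝔖 k).box h)))
    (bd : Hist S.P (k + 1) → GaugeField S.P (k + 1) G → ℝ)
    (hbd : ∀ h U, ∀ᵐ ω ∂(((𝔖 k).μ).restrict ((𝔖 k).box h)), |(𝔖 k).𝒱 h U ω| ≤ bd h U) :
    B10Eq24Cumulant.FluctuationModel (seriesPieces B 𝔖 C k) (𝔖 k).Fl where
  ν h _ := ((𝔖 k).μ).restrict ((𝔖 k).box h)
  fin h U := inferInstance
  ne h U := ⟨fun h0 => hbox h (by simpa using congrArg (fun m : Measure (𝔖 k).Fl => m Set.univ) h0)⟩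
  mass_le_one h U := by
    rw [measureReal_def, Measure.restrict_apply MeasurableSet.univ, Set.univ_inter]
    exact ENNReal.toReal_le_of_le_ofReal zero_le_one (by simpa using prob_le_one (μ := (𝔖 k).μ) (s := (𝔖 k).box h))
  V := (𝔖 k).𝒱
  V_ae := hV
  bd := bd
  V_le := hbd
  N := N
  C₀ := 0
  logFl_le h U := by
    show Real.log _ ≤ Real.log _ + 0 * _
    rw [zero_mul, add_zero]
  le_logFl U := by
    show Real.log _ - 0 * _ ≤ Real.log _
    rw [zero_mul, sub_zero]

end Leaves

end Summit.QuantumFields.Balaban3D.Carriers
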